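import Literature.Geometry.Symplectic.JHolomorphicLocalIntersections
import Literature.Geometry.Symplectic.JHolomorphicChartLocalization
import Literature.Geometry.Symplectic.JHolomorphicSheetDichotomy
import HarnessLib

/-!
# Proof of `jHolomorphic_intersectionDichotomy` (McDuff 1991, Lemma 2.7)

Discharge of the named fact `Literature.Geometry.Symplectic.jHolomorphic_intersectionDichotomy`
(D. McDuff, *The local behaviour of holomorphic curves in almost complex 4-manifolds*, J.
Differential Geom. 34 (1991), **Lemma 2.7**, p. 150: "if `C` and `C'` are distinct connected
`J`-holomorphic curves, then every accumulation point in the intersection `C ∩ C'` is critical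
on both curves"; in the two-branch form vendored in
`Literature/Geometry/Symplectic/JHolomorphicLocalIntersections.lean`: two smooth
`J`-holomorphic `G₁, G₂ : ℂ → V` with `G₁ 0 = G₂ 0`, `G₂` regular at `0`, `G₁` not locally
constant at `0`, either meet in an isolated pair of parameters or have the same image germ).

We FOLLOW THE PRINTED PROOF (McDuff, p. 150): "assume that `x ∈ C ∩ C'` is a nonsingular point
of `C'` … Choose coordinates so that `f'(z) = (z, 0, …, 0)` and `J = J₀` on the axis … if one of
the `fⁱ`, `2 ≤ i ≤ n`, has a nonzero Taylor expansion at `{0}`, `x` must be an isolated point of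
`Im f ∩ Im f'`. On the other hand, if these Taylor expansions all vanish, it follows from Lemma 2.4
[Aronszajn] that the `fⁱ`, `i ≥ 2`, all vanish. But then `C = C'` locally". In the tree this is
organised as follows.

* **Chart localisation** (`JHolomorphicChartLocalization.lean`): at `p = G₂ 0` the almost
  complex structure has a globally smooth coordinate expression `J'` on `ℝ⁴`
  (`exists_coordinateACS_global`) and the two curves have globally smooth chart expressions
  `b` (of `G₂`, immersed at `0`) and `v` (of `G₁`), `J'`-holomorphic on discs about `0`
  (`exists_chartCurve_global`).
* **McDuff's coordinates and the dichotomy for the normal component**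
  (`Literature.Geometry.Symplectic.sheet_dichotomy`, `JHolomorphicSheetDichotomy.lean`): in the
  sheet chart `e = sheetChart J' b ν₀` along the immersed branch `b` (McDuff's Lemma 2.5
  coordinates, in which `b` is the axis and `dE` is `J'`-complex-linear along it) write
  `e.symm (v ζ) = (a ζ, c ζ)`; then EITHER the normal coordinate `c` vanishes identically near
  `0` OR `0` is an isolated zero of `c` (the tree proves this with the Carleman similarity
  principle `similarity_local_dichotomy` in place of Aronszajn's theorem — the same unique
  continuation input, Lemma 2.4 of the paper).
* **Isolated zero ⇒ isolated intersection**: if `G₁ s = G₂ t` with `s, t` small then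
  `v s = b t = e (t, 0)`, so `c s = 0`, whence `s = 0`, and then `(t, 0) = e.symm (v 0) = (0, 0)`.
* **`c ≡ 0` ⇒ same image germ** ("`C = C'` locally"): then `v = b ∘ a` near `0`, i.e.
  `G₁ = G₂ ∘ a` near `0` with `a 0 = 0`; the tangential coordinate `a` is HOLOMORPHIC (both `v`
  and `b` are `J'`-holomorphic and `db` is injective near `0`, so `da ∘ i = i ∘ da`) and not
  locally constant (as `G₁` is not), hence open at `0` (Mathlib's open mapping theorem
  `AnalyticAt.eventually_constant_or_nhds_le_map_nhds`); continuity of `a` gives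
  `G₁(B_{ρ'}) ⊆ G₂(B_ρ)` and openness gives `G₂(B_{ρ'}) ⊆ G₁(B_ρ)`.

No new definitions and no named facts are introduced; this file only performs the assembly
(the sibling `JHolomorphicLocalIntersectionsProofs.lean` serves the other facts of that file).

## References

* D. McDuff, *The local behaviour of holomorphic curves in almost complex 4-manifolds*,
  J. Differential Geom. 34 (1991) 143–164, Lemma 2.7 (p. 150), Lemmas 2.4–2.5 (p. 147–148).
  [McDuff1991LocalBehaviour]
* C. Wendl, *Lectures on Holomorphic Curves in Symplectic and Contact Geometry* (2010/2014),
  Thm 2.87 / 2.88 (the same dichotomy via the representation `G₁ = v ∘ φ`). [WendlLectures2010]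
-/

noncomputable section

open scoped Manifold ContDiff Topology
open Set Function Metric Filter

namespace Literature.Geometry.Symplectic

/-- **McDuff 1991, Lemma 2.7 (two branches through a point, one regular): the named fact
`jHolomorphic_intersectionDichotomy` holds.** For smooth `J`-holomorphic `G₁, G₂ : ℂ → V` in a
smooth almost complex `4`-manifold with `G₁ 0 = G₂ 0`, `dG₂(0)` injective and `G₁` not locally
constant at `0`: either the only pair `(s, t)` of small parameters with `G₁ s = G₂ t` is `(0, 0)`,
or for every `ρ > 0` some `ρ' > 0` has `G₁(B_{ρ'}) ⊆ G₂(B_ρ)` and `G₂(B_{ρ'}) ⊆ G₁(B_ρ)`.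
Proof: McDuff's, p. 150 — coordinates adapted to the regular branch (`sheet_dichotomy`: the
normal coordinate of `G₁` vanishes identically or has an isolated zero), then the holomorphic
tangential coordinate and the open mapping theorem. [cite: McDuff1991LocalBehaviour, Lemma 2.7] -/
theorem jHolomorphic_intersectionDichotomy_holds : jHolomorphic_intersectionDichotomy := by
  intro V _ _ _ _ _ J hJ2 hJsm G₁ G₂ hG₁ hG₁J hG₂ hG₂J h0 hinj hfreq
  -- ### Step 1: chart localisation at `p = G₂ 0`
  obtain ⟨J', δ, hδ, hJ', hJ'E, hJ'2⟩ := exists_coordinateACS_global J hJ2 hJsm (G₂ 0)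
  obtain ⟨b, R₁, hR₁, hb, hbR, hbJ, hb0⟩ :=
    exists_chartCurve_global J hJ'E hG₂ hG₂J (z₀ := 0) rfl hδ
  obtain ⟨v, R₂, hR₂, hv, hvR, hvJ, -⟩ :=
    exists_chartCurve_global J hJ'E hG₁ hG₁J (z₀ := 0) h0 hδ
  -- `J'² = -1` along `b`, `db(0)` injective, `v 0 = b 0`
  have hJ2b : ∀ z ∈ ball (0 : ℂ) R₁, ∀ w, J' (b z) (J' (b z) w) = -w := fun z hz w => by
    obtain ⟨hsrc, hbz, hball⟩ := hbR z hz
    rw [hbz] at hball ⊢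
    exact hJ'2 (G₂ z) hsrc hball w
  have hinj' : Injective (fderiv ℝ b 0) := hb0 hinj
  have hx : v 0 = b 0 := by
    obtain ⟨-, hv0, -⟩ := hvR 0 (mem_ball_self hR₂)
    obtain ⟨-, hb0', -⟩ := hbR 0 (mem_ball_self hR₁)
    rw [hv0, hb0', h0]
  have h4 : Module.finrank ℝ (EuclideanSpace ℝ (Fin 4)) = 4 := finrank_euclideanSpace_fin
  -- the chart is injective on its domain
  have hφinj : InjOn (extChartAt (𝓡 4) (G₂ 0))
      (chartAt (EuclideanSpace ℝ (Fin 4)) (G₂ 0)).source := by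
    rw [← extChartAt_source (𝓡 4)]
    exact (extChartAt (𝓡 4) (G₂ 0)).injOn
  -- ### Step 2: McDuff's coordinates along the regular branch and the dichotomy for the
  -- normal component (`sheet_dichotomy`)
  obtain ⟨ν₀, e, ρ₀, hcoe, hsrc, hsymm, hρ₀, htgt, hdich⟩ :=
    sheet_dichotomy h4 hJ' (z₁ := 0) (z₂ := 0) hR₁ hR₂ hb hbJ hJ2b hinj' hv hvJ hx
  have hbe : ∀ z : ℂ, b z = e (z, 0) := fun z => by rw [hcoe, sheetChart_mk_zero]
  have he00 : e.symm (v 0) = (0, 0) := by rw [hx, hbe]; exact e.left_inv hsrc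
  -- points `(t, 0)` with `t` small lie in the source of `e`
  have hι : Continuous fun t : ℂ => ((t, 0) : ℂ × ℂ) := by fun_prop
  obtain ⟨τ, hτ, hτsrc⟩ := Metric.eventually_nhds_iff_ball.1
    (hι.continuousAt.preimage_mem_nhds (e.open_source.mem_nhds (by simpa using hsrc)))
  rcases hdich with hzero | ⟨ε, hε, -, hne, -⟩
  · -- ### Step 3: the normal coordinate vanishes identically: same image germ
    right
    -- the tangential coordinate `a`
    obtain ⟨a, ha⟩ : ∃ a : ℂ → ℂ, ∀ ζ, a ζ = (e.symm (v ζ)).1 := ⟨_, fun _ => rfl⟩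
    have ha0 : a 0 = 0 := by rw [ha, he00]
    have hsv : ContDiffOn ℝ ∞ (fun ζ => e.symm (v ζ)) (ball 0 ρ₀) :=
      hsymm.comp hv.contDiffOn fun ζ hζ => htgt ζ hζ
    have ha_smooth : ContDiffOn ℝ ∞ a (ball 0 ρ₀) := by
      rw [show a = fun ζ => (e.symm (v ζ)).1 from funext ha]
      exact contDiff_fst.comp_contDiffOn hsv
    have ha_cont : ContinuousAt a 0 :=
      ha_smooth.continuousOn.continuousAt (isOpen_ball.mem_nhds (mem_ball_self hρ₀))
    -- `v = b ∘ a` near `0`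
    have hvba : ∀ᶠ ζ in 𝓝 (0 : ℂ), v ζ = b (a ζ) := by
      filter_upwards [hzero, isOpen_ball.mem_nhds (mem_ball_self hρ₀)] with ζ h2 hζ
      rw [ha]
      exact eq_sheet_of_snd_symm_eq_zero hcoe (htgt ζ hζ) h2
    -- `a ζ` is small for `ζ` small, and then `G₁ ζ = G₂ (a ζ)`
    have ha_ev : ∀ᶠ ζ in 𝓝 (0 : ℂ), a ζ ∈ ball (0 : ℂ) (min R₁ τ) :=
      ha_cont.preimage_mem_nhds
        (isOpen_ball.mem_nhds (by rw [ha0]; exact mem_ball_self (lt_min hR₁ hτ)))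
    have hG₁₂ : ∀ᶠ ζ in 𝓝 (0 : ℂ), G₁ ζ = G₂ (a ζ) := by
      filter_upwards [hvba, ha_ev, isOpen_ball.mem_nhds (mem_ball_self hR₂)] with ζ h1 h2 h3
      obtain ⟨hs1, hv1, -⟩ := hvR ζ h3
      obtain ⟨hs2, hb2, -⟩ := hbR (a ζ) (ball_subset_ball (min_le_left _ _) h2)
      exact hφinj hs1 hs2 (by rw [← hv1, ← hb2, h1])
    -- `de` is injective on the source of `e` (it has the left inverse `d(e.symm)`)
    have hE : ContDiff ℝ ∞ (e : ℂ × ℂ → EuclideanSpace ℝ (Fin 4)) := by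
      rw [hcoe]; exact contDiff_sheetChart hJ' hb ν₀
    have hDe_inj : ∀ q ∈ e.source, Injective (fderiv ℝ e q) := by
      intro q hq
      have hqt : e q ∈ e.target := e.map_source hq
      have h1 : HasFDerivAt e (fderiv ℝ e q) q := (hE.differentiable (by simp) q).hasFDerivAt
      have h2 : HasFDerivAt e.symm (fderiv ℝ e.symm (e q)) (e q) :=
        ((hsymm.differentiableOn (by simp) _ hqt).differentiableAt
          (e.open_target.mem_nhds hqt)).hasFDerivAt
      have h3 : HasFDerivAt (e.symm ∘ e) (ContinuousLinearMap.id ℝ (ℂ × ℂ)) q :=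
        (hasFDerivAt_id q).congr_of_eventuallyEq
          (by filter_upwards [e.open_source.mem_nhds hq] with y hy using e.left_inv hy)
      have h5 := (h2.comp q h1).unique h3
      intro w₁ w₂ hw
      have := congrArg (fderiv ℝ e.symm (e q)) hw
      rwa [← ContinuousLinearMap.comp_apply, ← ContinuousLinearMap.comp_apply, h5] at this
    -- hence `db` is injective at every `t` with `(t, 0) ∈ e.source` (`b = e ∘ (·, 0)`)
    have hDb_inj : ∀ t : ℂ, ((t, 0) : ℂ × ℂ) ∈ e.source → Injective (fderiv ℝ b t) := by
      intro t ht
      have hιd : HasFDerivAt (fun s : ℂ => ((s, 0) : ℂ × ℂ))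
          ((ContinuousLinearMap.id ℝ ℂ).prod (0 : ℂ →L[ℝ] ℂ)) t :=
        (hasFDerivAt_id t).prodMk (hasFDerivAt_const (0 : ℂ) t)
      have hcomp : HasFDerivAt b
          ((fderiv ℝ e (t, 0)).comp ((ContinuousLinearMap.id ℝ ℂ).prod (0 : ℂ →L[ℝ] ℂ))) t := by
        rw [show b = (e : ℂ × ℂ → EuclideanSpace ℝ (Fin 4)) ∘ fun s : ℂ => ((s, 0) : ℂ × ℂ) from
          funext fun s => hbe s]
        exact (hE.differentiable (by simp) _).hasFDerivAt.comp t hιd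
      rw [hcomp.fderiv]
      intro w₁ w₂ hw
      have := hDe_inj _ ht hw
      simpa using this
    -- `a` is complex differentiable on a disc about `0`
    obtain ⟨η, hη, hηb⟩ := Metric.eventually_nhds_iff_ball.1
      (hvba.and (ha_ev.and (isOpen_ball.mem_nhds (mem_ball_self (lt_min hρ₀ hR₂)) :
        ball (0 : ℂ) (min ρ₀ R₂) ∈ 𝓝 (0 : ℂ))))
    have hdiffC : DifferentiableOn ℂ a (ball 0 η) := by
      intro ζ hζ
      obtain ⟨h1, h2, h3⟩ := hηb ζ hζ
      simp only [mem_ball, dist_zero_right, lt_min_iff] at h2 h3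
      have hζρ₀ : ζ ∈ ball (0 : ℂ) ρ₀ := by rw [mem_ball, dist_zero_right]; exact h3.1
      have haR : DifferentiableAt ℝ a ζ :=
        (ha_smooth.differentiableOn (by simp) ζ hζρ₀).differentiableAt
          (isOpen_ball.mem_nhds hζρ₀)
      have hbR' : DifferentiableAt ℝ b (a ζ) := hb.differentiable (by simp) _
      -- `v = b ∘ a` near `ζ`, so `dv = db ∘ da`
      have hev : v =ᶠ[𝓝 ζ] (b ∘ a) := by
        filter_upwards [isOpen_ball.mem_nhds hζ] with y hy using (hηb y hy).1
      have hDv : fderiv ℝ v ζ = (fderiv ℝ b (a ζ)).comp (fderiv ℝ a ζ) := by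
        rw [hev.fderiv_eq, fderiv_comp ζ hbR' haR]
      -- `J'`-holomorphy of `v` and `b` and injectivity of `db` give `da ∘ i = i ∘ da`
      have hI : ∀ θ : ℂ, fderiv ℝ a ζ (Complex.I * θ) = Complex.I * fderiv ℝ a ζ θ := by
        intro θ
        refine hDb_inj (a ζ) (hτsrc _ (by rw [mem_ball, dist_zero_right]; exact h2.2)) ?_
        have hvJζ := hvJ ζ (by rw [mem_ball, dist_zero_right]; exact h3.2) θ
        rw [hDv, ContinuousLinearMap.comp_apply, ContinuousLinearMap.comp_apply, h1] at hvJζ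
        rw [hvJζ]
        exact (hbJ (a ζ) (by rw [mem_ball, dist_zero_right]; exact h2.1) (fderiv ℝ a ζ θ)).symm
      exact ((differentiableAt_iff_restrictScalars ℝ haR).2
        (exists_restrictScalars_eq_of_map_mul_I (fderiv ℝ a ζ) fun θ => by
          rw [smul_eq_mul]; exact hI θ)).differentiableWithinAt
    have ha_an : AnalyticAt ℂ a 0 := hdiffC.analyticAt (isOpen_ball.mem_nhds (mem_ball_self hη))
    -- the open mapping theorem for `a`
    rcases ha_an.eventually_constant_or_nhds_le_map_nhds with hconst | hopen
    · -- `a` constant near `0` would make `G₁` locally constant at `0`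
      exfalso
      refine hfreq ?_
      filter_upwards [hconst, hG₁₂] with z h1 h2
      rw [h2, h1, ha0, ← h0]
      exact not_not.2 rfl
    · intro ρ hρ
      -- `G₁ = G₂ ∘ a` with `a` small on a disc `B_{η₂}`
      obtain ⟨η₂, hη₂, hη₂b⟩ := Metric.eventually_nhds_iff_ball.1
        (hG₁₂.and (ha_cont.preimage_mem_nhds
          (isOpen_ball.mem_nhds (by rw [ha0]; exact mem_ball_self hρ) :
            ball (0 : ℂ) ρ ∈ 𝓝 (a 0))))
      -- `a(B_{min η₂ ρ})` is a neighbourhood of `0 = a 0`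
      have hT : a '' ball (0 : ℂ) (min η₂ ρ) ∈ 𝓝 (0 : ℂ) := by
        have := hopen (image_mem_map (isOpen_ball.mem_nhds (mem_ball_self (lt_min hη₂ hρ))))
        rwa [ha0] at this
      obtain ⟨η₃, hη₃, hη₃b⟩ := Metric.mem_nhds_iff.1 hT
      refine ⟨min η₂ η₃, lt_min hη₂ hη₃, ?_, ?_⟩
      · rintro _ ⟨s, hs, rfl⟩
        obtain ⟨h1, h2⟩ := hη₂b s (ball_subset_ball (min_le_left _ _) hs)
        exact ⟨a s, h2, h1.symm⟩
      · rintro _ ⟨t, ht, rfl⟩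
        obtain ⟨s, hs, rfl⟩ := hη₃b (ball_subset_ball (min_le_right _ _) ht)
        simp only [mem_ball, dist_zero_right, lt_min_iff] at hs
        obtain ⟨h1, -⟩ := hη₂b s (by rw [mem_ball, dist_zero_right]; exact hs.1)
        exact ⟨s, by rw [mem_ball, dist_zero_right]; exact hs.2, h1⟩
  · -- ### Step 4: `0` is an isolated zero of the normal coordinate: isolated intersection
    left
    refine ⟨min ε (min τ (min R₁ R₂)), lt_min hε (lt_min hτ (lt_min hR₁ hR₂)), ?_⟩
    intro s hs t ht hst
    simp only [mem_ball, dist_zero_right, lt_min_iff] at hs ht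
    obtain ⟨hsε, -, -, hsR₂⟩ := hs
    obtain ⟨-, htτ, htR₁, -⟩ := ht
    obtain ⟨-, hvs, -⟩ := hvR s (by rwa [mem_ball, dist_zero_right])
    obtain ⟨-, hbt, -⟩ := hbR t (by rwa [mem_ball, dist_zero_right])
    -- `v s = b t = e (t, 0)`, so the normal coordinate of `v s` vanishes
    have hsymm_vs : e.symm (v s) = (t, 0) := by
      rw [hvs, hst, ← hbt, hbe]
      exact e.left_inv (hτsrc t (by rwa [mem_ball, dist_zero_right]))
    have hs0 : s = 0 := by
      by_contra hs0
      refine hne s (by rw [sub_zero]; exact norm_pos_iff.2 hs0) (by rw [sub_zero]; exact hsε.le) ?_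
      rw [hsymm_vs]
    subst hs0
    rw [he00, Prod.mk.injEq] at hsymm_vs
    exact ⟨rfl, hsymm_vs.1.symm⟩

end Literature.Geometry.Symplectic
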